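import Literature.Computability.MetaComplexity.Hirahara2020.ReadOnceBranchingProgramsDL
import Literature.Computability.MetaComplexity.MCSPStatisticalTest
import Literature.InformationTheory.Coding.HammingBall
import HarnessLib

/-!
# Hirahara (ToC 19(4) 2023 / FOCS 2020) Thm. 1.13, KNOWN side in the SAME model — the variable
# light cone of a nondeterministic branching program: no contact scheme with fewer than
# `N − N^{max(α,1−ρα)+o(1)}` contacts co-solves `DSPACE(cn)/ₙcn vs S̃IZE(2^{αn}; 2^{−ραn})`

Topic `Literature/Computability/MetaComplexity` (pub census cell, typer2 g11; row R28, K column).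
Companion of `Hirahara2020/ReadOnceBranchingPrograms.lean` (rendering (I): the `c`-th promise problem
`Hirahara2020.DSPACEvsApproxSIZE c α ρ = ⟨smallBPYes c, approxHardNo α ρ⟩`, the device class
`NondetBranchingProgram (2^n)` — Jukna contact schemes, size = number of contacts — and the dual-form
co-solving predicate `CoSolves`; the NEEDED hypothesis of Thm. 1.13 is
`Hirahara2020.Thm113Hypothesis ρ α β c`: for all large `n`, no READ-ONCE scheme of size
`≤ powSize (1+β) (2^n) = ⌊N^{1+β}⌋` co-solves, `β > 0`) and of
`Hirahara2020/ReadOnceBranchingProgramsDL.lean` (rendering (II), YES side `dlYes c`).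

## What is proved here (all PROVED, no new facts, no new devices)

A folklore locality ("light cone") bound, kernel-checked; it is NOT a result stated in print for this
promise problem (the printed same-device numbers concern other problems: Cheraghchi–Hirahara–
Myrisiotis–Yoshida ToCS 2022 Cor. 7 for `MCSP`, typed in `CheraghchiEtAl2022/…`; Hirahara ToC 2023
p. 13 L26–29 quotes the Nechiporuk bound `o(N^{1.5}/log N)` for `MKtP` [17]).

* `NondetBranchingProgram.card_readVars_le_size` (the variables occurring in contacts number
  `≤ size`: every read variable costs a contact) and `NondetBranchingProgram.accepts_iff_of_agree`
  (acceptance depends only on the values of the contact variables). No definition is introduced.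
* `Hirahara2020.exists_agree_mem_approxHardNo` — RELATIVE COUNTING: if
  `#D + (3n+6)·(⌊N^α⌋ + ⌊N^{1−ρα}⌋ + 1) < N = 2^n`, then for every set `D` of points of the cube and
  every `f₀` some `g` AGREEING with `f₀` on `D` is a NO instance (more than `N^{1−ρα}`-far from every
  `B₂`-circuit with `≤ ⌊N^α⌋` gates): the fibre `{g | g =_D f₀}` has `≥ 2^{N−#D}` members while the
  functions within Hamming distance `⌊N^{1−ρα}⌋` of a function of circuit complexity `≤ ⌊N^α⌋` number
  `≤ 2^{(2n+6)s + n·r + 3n+3}` (`card_filter_circuitSizeOver_le`,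
  `Literature.InformationTheory.Coding.card_filter_hammingDist_le_le`).
* `Hirahara2020.not_coSolves_of_size_add_budget_lt` — hence a scheme `P` on `N = 2^n` variables with
  `P.size + (3n+6)(⌊N^α⌋ + ⌊N^{1−ρα}⌋ + 1) < N` co-solves NO promise problem `⟨Y, approxHardNo α ρ⟩`
  whose YES side contains a truth table of length `N`: take the YES witness `f₀`, `D :=` the read
  positions (contact variables); the NO instance `g` of the previous item agrees with `f₀` on everything `P` reads, so `P`
  accepts `tt g` iff it accepts `tt f₀` — but a co-solver accepts the former and rejects the latter.
  READ-ONCE IS NOT USED: the bound holds for every nondeterministic contact scheme.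
* Asymptotics (`eventually_mul_rpow_lt_rpow`: `A·(n+1)·N^γ < N^θ` eventually for `γ < θ`):
  `eventually_not_coSolves_of_le_sub` (size `≤ N − ⌈N^θ⌉`, any `θ ∈ (max α (1−ρα), 1]`),
  `eventually_not_coSolves_of_le_powSize` (size `≤ ⌊N^κ⌋`, any `κ < 1`, for `0 < α < 1`, `0 < ρ`).
* Row R28's own predicates: `DSPACEvsApproxSIZE_not_coSolved_of_le_sub`,
  `DSPACEvsApproxSIZE_not_coSolved_of_lt_one` (rendering (I), every `c`; YES witness the constant
  function, `truthTable_const_mem_yes`), `DSPACEdlVsApproxSIZE_not_coSolved_of_lt_one` (rendering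
  (II), `1 ≤ c`, YES witness `truthTable_const_mem_dlYes`; for `c = 0` the YES side `dlYes 0` is empty,
  `Hirahara2020.dlYes_zero` in `DlYesNotSmallBPYes.lean`, and the accept-all scheme co-solves), and —
  LITERALLY THE NEEDED PREDICATE AT EVERY NEGATIVE `β` — `thm113Hypothesis_of_neg`
  (`Thm113Hypothesis ρ α β c` for all `β < 0`, `0 < α < 1`, `0 < ρ`, all `c`) and
  `thm113HypothesisDL_of_neg` (`1 ≤ c`). NEEDED (Thm. 1.13): some `β > 0`. The census comparison
  (same problem, same device class, same size measure; exponent `1 + β`, needed `β > 0` vs known every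
  `β < 0`) is recorded in `MagnificationGapCensus/ReadOnceBranchingProgramsKnown.lean`.
-/

namespace Literature.Computability.MetaComplexity

open Filter Topology Finset Literature.Computability.Complexity

namespace NondetBranchingProgram

variable {n : ℕ}

/-! ### The variable light cone of a contact scheme -/

/-- The distinct contact variables of a wire list number at most its contacts (so a scheme READS at
most `size` variables: `card_readVars_le_size`). [folklore] -/
theorem card_toFinset_filterMap_le_length_filter {m : ℕ}
    (l : List (Fin m × Option (Fin n × Bool) × Fin m)) :
    #((l.filterMap fun w => w.2.1.map Prod.fst).toFinset) ≤
      (l.filter fun w => w.2.1.isSome).length := by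
  induction l with
  | nil => simp
  | cons w l ih =>
    rcases hlab : w.2.1 with _ | ⟨i, b⟩
    · have h1 : ((w :: l).filterMap fun w => w.2.1.map Prod.fst) =
          l.filterMap fun w => w.2.1.map Prod.fst := by
        simp [hlab]
      have h2 : ((w :: l).filter fun w => w.2.1.isSome) = l.filter fun w => w.2.1.isSome := by
        simp [hlab]
      rw [h1, h2]
      exact ih
    · have h1 : ((w :: l).filterMap fun w => w.2.1.map Prod.fst) =
          i :: l.filterMap fun w => w.2.1.map Prod.fst := by
        simp [hlab]
      have h2 : ((w :: l).filter fun w => w.2.1.isSome) = w :: l.filter fun w => w.2.1.isSome := by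
        simp [hlab]
      rw [h1, h2, List.toFinset_cons, List.length_cons]
      exact (Finset.card_insert_le _ _).trans (by omega)

/-- **Every read variable costs a contact**: the set of variables occurring in the contacts of `P`,
`(P.wires.filterMap fun w => w.2.1.map Prod.fst).toFinset`, has at most `P.size` elements.
[folklore] -/
theorem card_readVars_le_size (P : NondetBranchingProgram n) :
    #((P.wires.filterMap fun w => w.2.1.map Prod.fst).toFinset) ≤ P.size :=
  card_toFinset_filterMap_le_length_filter P.wires

/-- A contact variable belongs to the set of read variables. [folklore] -/
theorem mem_readVars_of_label_eq {P : NondetBranchingProgram n}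
    {w : Fin P.m × Option (Fin n × Bool) × Fin P.m} (hw : w ∈ P.wires) {ib : Fin n × Bool}
    (hlab : w.2.1 = some ib) : ib.1 ∈ (P.wires.filterMap fun w => w.2.1.map Prod.fst).toFinset := by
  simp only [List.mem_toFinset, List.mem_filterMap]
  exact ⟨w, hw, by simp [hlab]⟩

/-- Inputs AGREEING ON THE CONTACTS of `P` (every contact's variable has the same value under both)
switch the same labels On. [folklore] -/
theorem labelOn_iff_of_agree {P : NondetBranchingProgram n} {x y : Fin n → Bool}
    (hxy : ∀ w ∈ P.wires, ∀ ib : Fin n × Bool, w.2.1 = some ib → x ib.1 = y ib.1)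
    {w : Fin P.m × Option (Fin n × Bool) × Fin P.m} (hw : w ∈ P.wires) :
    LabelOn x w.2.1 ↔ LabelOn y w.2.1 := by
  rcases hlab : w.2.1 with _ | ⟨i, b⟩
  · simp [LabelOn]
  · simp only [LabelOn]
    rw [hxy w hw (i, b) hlab]

/-- Steps along wires are the same for inputs agreeing on the contacts. [folklore] -/
theorem step_iff_of_agree {P : NondetBranchingProgram n} {x y : Fin n → Bool}
    (hxy : ∀ w ∈ P.wires, ∀ ib : Fin n × Bool, w.2.1 = some ib → x ib.1 = y ib.1)
    (u v : Fin P.m) : P.Step x u v ↔ P.Step y u v := by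
  unfold Step
  exact exists_congr fun w => and_congr_right fun hw =>
    and_congr_right fun _ => and_congr_right fun _ => labelOn_iff_of_agree hxy hw

/-- **Locality of acceptance (the variable light cone)**: inputs agreeing on the variables of the
contacts are accepted or rejected together. [folklore] -/
theorem accepts_iff_of_agree {P : NondetBranchingProgram n} {x y : Fin n → Bool}
    (hxy : ∀ w ∈ P.wires, ∀ ib : Fin n × Bool, w.2.1 = some ib → x ib.1 = y ib.1) :
    P.Accepts x ↔ P.Accepts y := by
  have h : P.Step x = P.Step y := by
    funext u v
    exact propext (step_iff_of_agree hxy u v)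
  unfold Accepts
  rw [h]

end NondetBranchingProgram

namespace Hirahara2020

open Literature.Computability.MetaComplexity UniversalMachine OliveiraPichSanthanam2019
open NondetBranchingProgram

/-! ### Reading a truth table -/

/-- The input vector of a truth table reads the function (in the order `boolFunEquivFin`).
[folklore] -/
theorem toInput_truthTable {n : ℕ} (g : (Fin n → Bool) → Bool) (i : Fin (2 ^ n)) :
    toInput (2 ^ n) (truthTable g) i = g ((boolFunEquivFin n).symm i) := by
  unfold toInput truthTable
  rw [List.getD_eq_getElem _ _ (by simp), List.getElem_ofFn]

/-! ### An eventual inequality: polynomial factors are swallowed by any gap in the exponent -/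

/-- For `γ < θ` and any real `A`: eventually `A·(n+1)·(2^n)^γ < (2^n)^θ`. [folklore] -/
theorem eventually_mul_rpow_lt_rpow {γ θ : ℝ} (hγθ : γ < θ) (A : ℝ) :
    ∀ᶠ n : ℕ in atTop, A * ((n : ℝ) + 1) * ((2 : ℝ) ^ n) ^ γ < ((2 : ℝ) ^ n) ^ θ := by
  rcases le_or_gt A 0 with hA | hA
  · refine Eventually.of_forall fun n => lt_of_le_of_lt ?_ (Real.rpow_pos_of_pos (by positivity) θ)
    have h1 : A * ((n : ℝ) + 1) ≤ 0 := mul_nonpos_iff.2 (Or.inr ⟨hA, by positivity⟩)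
    exact mul_nonpos_iff.2 (Or.inr ⟨h1, by positivity⟩)
  · set r : ℝ := (2 : ℝ) ^ (θ - γ) with hrdef
    have hr1 : 1 < r := Real.one_lt_rpow (by norm_num) (by linarith)
    have hlim := tendsto_pow_const_div_const_pow_of_one_lt 1 hr1
    have hpos : (0 : ℝ) < 1 / (2 * A) := by positivity
    have hev : ∀ᶠ n : ℕ in atTop, (n : ℝ) ^ 1 / r ^ n < 1 / (2 * A) :=
      hlim.eventually (gt_mem_nhds hpos)
    filter_upwards [hev, eventually_ge_atTop 1] with n hn hn1
    have hrn : (0 : ℝ) < r ^ n := by positivity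
    rw [pow_one, div_lt_iff₀ hrn] at hn
    have hn1' : (1 : ℝ) ≤ n := by exact_mod_cast hn1
    have hN : (0 : ℝ) < (2 : ℝ) ^ n := by positivity
    have hrpow : r ^ n = ((2 : ℝ) ^ n) ^ (θ - γ) := by
      rw [hrdef, ← Real.rpow_mul_natCast (by norm_num : (0:ℝ) ≤ 2),
        show (θ - γ) * (n : ℝ) = (n : ℝ) * (θ - γ) by ring,
        Real.rpow_mul (by norm_num : (0:ℝ) ≤ 2), Real.rpow_natCast]
    have h2A : (0 : ℝ) < 2 * A := by positivity
    have h3 : 2 * A * (n : ℝ) < r ^ n := by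
      have h4 := mul_lt_mul_of_pos_left hn h2A
      have h5 : 2 * A * (1 / (2 * A) * r ^ n) = r ^ n := by
        field_simp
      linarith [h4, h5]
    have h1 : A * ((n : ℝ) + 1) < r ^ n := by
      have h2 : A * ((n : ℝ) + 1) ≤ 2 * A * n := by nlinarith
      linarith
    calc A * ((n : ℝ) + 1) * ((2 : ℝ) ^ n) ^ γ
        < r ^ n * ((2 : ℝ) ^ n) ^ γ := mul_lt_mul_of_pos_right h1 (by positivity)
      _ = ((2 : ℝ) ^ n) ^ θ := by
          rw [hrpow, ← Real.rpow_add hN]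
          congr 1
          ring

/-- The counting budget `(3n+6)·(⌊N^α⌋ + ⌊N^{1−ρα}⌋ + 1)` is eventually below `N^θ` for every
`θ > max α (1−ρα)` (`N = 2^n`, `α > 0`). [folklore] -/
theorem eventually_budget_lt_rpow {α θ : ℝ} (hα : 0 < α) (ρ : ℝ) (hθ : max α (1 - ρ * α) < θ) :
    ∀ᶠ n : ℕ in atTop,
      (((3 * n + 6) * (powThreshold α (2 ^ n) + ⌊((2 : ℝ) ^ n) ^ (1 - ρ * α)⌋₊ + 1) : ℕ) : ℝ)
        < ((2 : ℝ) ^ n) ^ θ := by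
  set γ : ℝ := max α (1 - ρ * α) with hγdef
  have hγ0 : 0 < γ := lt_max_of_lt_left hα
  filter_upwards [eventually_mul_rpow_lt_rpow hθ 18] with n hn
  have hN1 : (1 : ℝ) ≤ (2 : ℝ) ^ n := one_le_pow₀ (by norm_num)
  have hNγ1 : (1 : ℝ) ≤ ((2 : ℝ) ^ n) ^ γ := Real.one_le_rpow hN1 hγ0.le
  have hs : (powThreshold α (2 ^ n) : ℝ) ≤ ((2 : ℝ) ^ n) ^ γ := by
    unfold powThreshold
    refine (Nat.floor_le (by positivity)).trans ?_
    push_cast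
    exact Real.rpow_le_rpow_of_exponent_le hN1 (le_max_left _ _)
  have hR : (⌊((2 : ℝ) ^ n) ^ (1 - ρ * α)⌋₊ : ℝ) ≤ ((2 : ℝ) ^ n) ^ γ :=
    (Nat.floor_le (by positivity)).trans (Real.rpow_le_rpow_of_exponent_le hN1 (le_max_right _ _))
  have hn0 : (0 : ℝ) ≤ n := Nat.cast_nonneg n
  push_cast
  calc (3 * (n : ℝ) + 6) *
        ((powThreshold α (2 ^ n) : ℝ) + (⌊((2 : ℝ) ^ n) ^ (1 - ρ * α)⌋₊ : ℝ) + 1)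
      ≤ (3 * (n : ℝ) + 6) * (3 * ((2 : ℝ) ^ n) ^ γ) :=
        mul_le_mul_of_nonneg_left (by linarith) (by positivity)
    _ = (9 * (n : ℝ) + 18) * ((2 : ℝ) ^ n) ^ γ := by ring
    _ ≤ (18 * ((n : ℝ) + 1)) * ((2 : ℝ) ^ n) ^ γ :=
        mul_le_mul_of_nonneg_right (by linarith) (by positivity)
    _ = 18 * ((n : ℝ) + 1) * ((2 : ℝ) ^ n) ^ γ := by ring
    _ < ((2 : ℝ) ^ n) ^ θ := hn

/-- Polynomial budgets fit under the sub-threshold: for `κ ≤ θ`, `0 < θ < 1`, eventually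
`⌊N^κ⌋ ≤ N − ⌈N^θ⌉` (`N = 2^n`). [folklore] -/
theorem eventually_powSize_le_sub {κ θ : ℝ} (hκθ : κ ≤ θ) (hθ0 : 0 < θ) (hθ1 : θ < 1) :
    ∀ᶠ n : ℕ in atTop, powSize κ (2 ^ n) ≤ 2 ^ n - ⌈((2 : ℝ) ^ n) ^ θ⌉₊ := by
  filter_upwards [eventually_mul_rpow_lt_rpow hθ1 3] with n hn
  rw [Real.rpow_one] at hn
  have hN1 : (1 : ℝ) ≤ (2 : ℝ) ^ n := one_le_pow₀ (by norm_num)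
  have hNθ1 : (1 : ℝ) ≤ ((2 : ℝ) ^ n) ^ θ := Real.one_le_rpow hN1 hθ0.le
  have hfl : (powSize κ (2 ^ n) : ℝ) ≤ ((2 : ℝ) ^ n) ^ θ := by
    unfold powSize
    refine (Nat.floor_le (by positivity)).trans ?_
    push_cast
    exact Real.rpow_le_rpow_of_exponent_le hN1 hκθ
  have hce : (⌈((2 : ℝ) ^ n) ^ θ⌉₊ : ℝ) < ((2 : ℝ) ^ n) ^ θ + 1 :=
    Nat.ceil_lt_add_one (by positivity)
  have hn0 : (0 : ℝ) ≤ n := Nat.cast_nonneg n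
  have h3 : 3 * ((2 : ℝ) ^ n) ^ θ ≤ 3 * ((n : ℝ) + 1) * ((2 : ℝ) ^ n) ^ θ := by
    nlinarith [hNθ1, hn0]
  have hsum : (((powSize κ (2 ^ n) + ⌈((2 : ℝ) ^ n) ^ θ⌉₊ : ℕ)) : ℝ) < ((2 ^ n : ℕ) : ℝ) := by
    push_cast
    linarith
  have hlt : powSize κ (2 ^ n) + ⌈((2 : ℝ) ^ n) ^ θ⌉₊ < 2 ^ n := by exact_mod_cast hsum
  omega

/-! ### Relative counting: a far-from-small-circuits function inside any large fibre -/

/-- **Relative counting (Arora–Barak Thm. 6.21, approximate version, inside a fibre).** If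
`#D + (3n+6)·(⌊N^α⌋ + ⌊N^{1−ρα}⌋ + 1) < N = 2^n`, then every function `f₀` has a companion `g`
agreeing with it on `D` whose truth table is a NO instance of `approxHardNo α ρ` (every `B₂`-circuit
with `≤ ⌊N^α⌋` gates disagrees with `g` on more than `N^{1−ρα}` inputs): the fibre has `≥ 2^{N−#D}`
members, the near-easy functions number `≤ 2^{(2n+6)s + n·r + 3n+3}`. [folklore] -/
theorem exists_agree_mem_approxHardNo {α ρ : ℝ} {n : ℕ} (D : Finset (Fin n → Bool))
    (f₀ : (Fin n → Bool) → Bool)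
    (hD : #D + (3 * n + 6) * (powThreshold α (2 ^ n) + ⌊((2 : ℝ) ^ n) ^ (1 - ρ * α)⌋₊ + 1)
      < 2 ^ n) :
    ∃ g : (Fin n → Bool) → Bool, (∀ v ∈ D, g v = f₀ v) ∧ truthTable g ∈ approxHardNo α ρ := by
  classical
  set s : ℕ := powThreshold α (2 ^ n) with hsdef
  set r : ℕ := ⌊((2 : ℝ) ^ n) ^ (1 - ρ * α)⌋₊ with hrdef
  -- crude size facts from the budget hypothesis
  have hmul : s + r + 1 ≤ (3 * n + 6) * (s + r + 1) := Nat.le_mul_of_pos_left _ (by omega)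
  have hmul' : 3 * n + 6 ≤ (3 * n + 6) * (s + r + 1) := Nat.le_mul_of_pos_right _ (by omega)
  have hsN : s < 2 ^ n := by omega
  have hrN : r < 2 ^ n := by omega
  have hnN : n + 1 ≤ 2 ^ n := by omega
  -- the fibre of `f₀` over `D`
  let G : Finset ((Fin n → Bool) → Bool) := {g | ∀ v ∈ D, g v = f₀ v}
  have hG : 2 ^ (2 ^ n - #D) ≤ #G := by
    let ψ : (↥(Dᶜ) → Bool) → ((Fin n → Bool) → Bool) := fun u v =>
      if h : v ∈ D then f₀ v else u ⟨v, mem_compl.2 h⟩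
    have hψinj : Function.Injective ψ := by
      intro u u' huu'
      funext j
      have hj : (j : Fin n → Bool) ∉ D := mem_compl.1 j.2
      have := congrFun huu' j
      simpa [ψ, hj] using this
    have hψmem : ∀ u, ψ u ∈ G := fun u => by
      simp only [G, mem_filter, mem_univ, true_and]
      intro v hv
      simp [ψ, hv]
    calc 2 ^ (2 ^ n - #D) = Fintype.card (↥(Dᶜ) → Bool) := by
          rw [Fintype.card_fun, Fintype.card_bool, Fintype.card_coe, card_compl, Fintype.card_fun,
            Fintype.card_bool, Fintype.card_fin]
      _ = #(univ.image ψ) := by rw [card_image_of_injective _ hψinj, card_univ]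
      _ ≤ #G := card_le_card fun x hx => by
          obtain ⟨u, -, rfl⟩ := mem_image.1 hx
          exact hψmem u
  -- the BAD set: functions close to a function of small circuit complexity
  let centres : Finset ((Fin n → Bool) → Bool) := {g | circuitSizeOver B2 g ≤ s}
  let ball : ((Fin n → Bool) → Bool) → Finset ((Fin n → Bool) → Bool) :=
    fun g => {f | hammingDist f g ≤ r}
  let BAD : Finset ((Fin n → Bool) → Bool) := centres.biUnion ball
  have hcentres : #centres ≤ (s + 1) * (16 * (n + s + 1) ^ 2) ^ s * (n + s + 1) :=
    card_filter_circuitSizeOver_le n s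
  have hball : ∀ g, #(ball g) ≤ (r + 1) * (2 ^ n) ^ r := fun g => by
    refine (Literature.InformationTheory.Coding.card_filter_hammingDist_le_le g r).trans ?_
    have hM : Fintype.card (Fin n → Bool) = 2 ^ n := by
      rw [Fintype.card_fun, Fintype.card_bool, Fintype.card_fin]
    rw [hM]
    calc ∑ j ∈ range (r + 1), (2 ^ n).choose j ≤ ∑ _j ∈ range (r + 1), (2 ^ n) ^ r := by
          refine sum_le_sum fun j hj => ?_
          exact (Nat.choose_le_pow _ _).trans
            (Nat.pow_le_pow_right Nat.one_le_two_pow (Nat.lt_succ_iff.1 (mem_range.1 hj)))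
      _ = (r + 1) * (2 ^ n) ^ r := by simp
  -- exponent bookkeeping in `ℕ`
  have hts : n + s + 1 ≤ 2 ^ (n + 1) := by rw [pow_succ]; omega
  have hs1 : s + 1 ≤ 2 ^ (n + 1) := by rw [pow_succ]; omega
  have hr1 : r + 1 ≤ 2 ^ (n + 1) := by rw [pow_succ]; omega
  have h16 : 16 * (n + s + 1) ^ 2 ≤ 2 ^ (2 * n + 6) := by
    calc 16 * (n + s + 1) ^ 2 ≤ 16 * (2 ^ (n + 1)) ^ 2 :=
          Nat.mul_le_mul_left _ (Nat.pow_le_pow_left hts 2)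
      _ = 2 ^ (2 * n + 6) := by
          rw [← pow_mul, show (16 : ℕ) = 2 ^ 4 by norm_num, ← pow_add]; congr 1; ring
  have hBAD : #BAD ≤ 2 ^ ((2 * n + 6) * s + n * r + 3 * n + 3) := by
    calc #BAD ≤ ∑ g ∈ centres, #(ball g) := card_biUnion_le
      _ ≤ ∑ _g ∈ centres, (r + 1) * (2 ^ n) ^ r := sum_le_sum fun g _ => hball g
      _ = #centres * ((r + 1) * (2 ^ n) ^ r) := by simp
      _ ≤ ((s + 1) * (16 * (n + s + 1) ^ 2) ^ s * (n + s + 1)) * ((r + 1) * (2 ^ n) ^ r) :=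
          Nat.mul_le_mul_right _ hcentres
      _ ≤ (2 ^ (n + 1) * (2 ^ (2 * n + 6)) ^ s * 2 ^ (n + 1)) * (2 ^ (n + 1) * (2 ^ n) ^ r) := by
          gcongr
      _ = 2 ^ ((2 * n + 6) * s + n * r + 3 * n + 3) := by
          simp only [← pow_mul, ← pow_add]; congr 1; ring
  have hexp : (2 * n + 6) * s + n * r + 3 * n + 3 < 2 ^ n - #D := by
    have : (2 * n + 6) * s + n * r + 3 * n + 3 ≤ (3 * n + 6) * (s + r + 1) := by nlinarith
    omega
  have hlt : #BAD < #G :=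
    lt_of_lt_of_le (lt_of_le_of_lt hBAD (Nat.pow_lt_pow_right (by norm_num) hexp)) hG
  -- a member of the fibre outside BAD is far from every small circuit
  obtain ⟨g, hgG, hgBAD⟩ := exists_mem_notMem_of_card_lt_card hlt
  have hgD : ∀ v ∈ D, g v = f₀ v := by
    simpa only [G, mem_filter, mem_univ, true_and] using hgG
  refine ⟨g, hgD, n, g, rfl, fun C hC hCs => ?_⟩
  have hc : C.eval ∈ centres := by
    simp only [centres, mem_filter, mem_univ, true_and]
    exact (circuitSizeOver_le_of_computes C hC fun _ => rfl).trans hCs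
  have hfar : ¬ hammingDist g C.eval ≤ r := by
    intro hle
    exact hgBAD (mem_biUnion.2 ⟨C.eval, hc, by simpa [ball] using hle⟩)
  have hdist : hammingDist g C.eval = #{v : Fin n → Bool | C.eval v ≠ g v} := by
    rw [hammingDist_comm]
    rfl
  have hlt' : ((2 : ℝ) ^ n) ^ (1 - ρ * α) < (r : ℝ) + 1 := Nat.lt_floor_add_one _
  calc ((2 : ℝ) ^ n) ^ (1 - ρ * α) < (r : ℝ) + 1 := hlt'
    _ ≤ (hammingDist g C.eval : ℝ) := by exact_mod_cast not_le.1 hfar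
    _ = (#{v : Fin n → Bool | C.eval v ≠ g v} : ℝ) := by rw [hdist]

/-! ### The lower bound for contact schemes -/

/-- **No small contact scheme co-solves `⟨Y, approxHardNo α ρ⟩`.** If
`P.size + (3n+6)(⌊N^α⌋ + ⌊N^{1−ρα}⌋ + 1) < N = 2^n` and `Y` contains a truth table `tt f₀` of length
`N`, then `P` does not co-solve (dual form) the promise problem `⟨Y, approxHardNo α ρ⟩`: some NO
instance agrees with `f₀` on every variable `P` reads (`exists_agree_mem_approxHardNo` with `D` the
read positions, `#D ≤ P.size`), so `P` accepts it iff it accepts the YES instance `tt f₀`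
(`accepts_iff_of_agree`). Read-once is not assumed. [folklore] -/
theorem not_coSolves_of_size_add_budget_lt {α ρ : ℝ} {n : ℕ} (P : NondetBranchingProgram (2 ^ n))
    (hP : P.size + (3 * n + 6) * (powThreshold α (2 ^ n) + ⌊((2 : ℝ) ^ n) ^ (1 - ρ * α)⌋₊ + 1)
      < 2 ^ n)
    {Y : Set (List Bool)} {f₀ : (Fin n → Bool) → Bool} (hf₀ : truthTable f₀ ∈ Y) :
    ¬ P.CoSolves ⟨Y, approxHardNo α ρ⟩ := by
  classical
  intro hco
  let D : Finset (Fin n → Bool) :=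
    ((P.wires.filterMap fun w => w.2.1.map Prod.fst).toFinset).image (boolFunEquivFin n).symm
  have hD : #D ≤ P.size := card_image_le.trans P.card_readVars_le_size
  obtain ⟨g, hg, hgno⟩ := exists_agree_mem_approxHardNo (α := α) (ρ := ρ) D f₀
    (lt_of_le_of_lt (Nat.add_le_add_right hD _) hP)
  have hagree : ∀ w ∈ P.wires, ∀ ib : Fin (2 ^ n) × Bool, w.2.1 = some ib →
      toInput (2 ^ n) (truthTable g) ib.1 = toInput (2 ^ n) (truthTable f₀) ib.1 := by
    intro w hw ib hlab
    rw [toInput_truthTable, toInput_truthTable]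
    exact hg _ (mem_image_of_mem _ (mem_readVars_of_label_eq hw hlab))
  have h1 : P.Accepts (toInput (2 ^ n) (truthTable g)) :=
    (hco (truthTable g) (length_truthTable g)).1 hgno
  have h2 : ¬ P.Accepts (toInput (2 ^ n) (truthTable f₀)) :=
    (hco (truthTable f₀) (length_truthTable f₀)).2 hf₀
  exact h2 ((accepts_iff_of_agree hagree).1 h1)

/-- **Sub-threshold form.** For `α > 0` and `θ ∈ (max α (1−ρα), 1]`: for all large `n`, no contact
scheme on `N = 2^n` variables with at most `N − ⌈N^θ⌉` contacts co-solves `⟨Y, approxHardNo α ρ⟩`,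
provided `Y` eventually contains truth tables of every length `N`. [folklore] -/
theorem eventually_not_coSolves_of_le_sub {α ρ θ : ℝ} (hα : 0 < α) (hθ : max α (1 - ρ * α) < θ)
    (hθ1 : θ ≤ 1) {Y : Set (List Bool)}
    (hY : ∀ᶠ n : ℕ in atTop, ∃ f₀ : (Fin n → Bool) → Bool, truthTable f₀ ∈ Y) :
    ∀ᶠ n : ℕ in atTop, ∀ P : NondetBranchingProgram (2 ^ n),
      P.size ≤ 2 ^ n - ⌈((2 : ℝ) ^ n) ^ θ⌉₊ → ¬ P.CoSolves ⟨Y, approxHardNo α ρ⟩ := by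
  filter_upwards [eventually_budget_lt_rpow hα ρ hθ, hY] with n hn ⟨f₀, hf₀⟩ P hP
  refine not_coSolves_of_size_add_budget_lt P ?_ hf₀
  have h1 : (3 * n + 6) * (powThreshold α (2 ^ n) + ⌊((2 : ℝ) ^ n) ^ (1 - ρ * α)⌋₊ + 1)
      < ⌈((2 : ℝ) ^ n) ^ θ⌉₊ := Nat.lt_ceil.2 hn
  have h2 : ⌈((2 : ℝ) ^ n) ^ θ⌉₊ ≤ 2 ^ n := by
    refine Nat.ceil_le.2 ?_
    have hN1 : (1 : ℝ) ≤ (2 : ℝ) ^ n := one_le_pow₀ (by norm_num)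
    calc ((2 : ℝ) ^ n) ^ θ ≤ ((2 : ℝ) ^ n) ^ (1 : ℝ) := Real.rpow_le_rpow_of_exponent_le hN1 hθ1
      _ = ((2 ^ n : ℕ) : ℝ) := by rw [Real.rpow_one]; push_cast; rfl
  calc P.size + (3 * n + 6) * (powThreshold α (2 ^ n) + ⌊((2 : ℝ) ^ n) ^ (1 - ρ * α)⌋₊ + 1)
      < P.size + ⌈((2 : ℝ) ^ n) ^ θ⌉₊ := Nat.add_lt_add_left h1 _
    _ ≤ 2 ^ n := by omega

/-- **Polynomial form.** For `0 < α < 1`, `0 < ρ` and every exponent `κ < 1`: for all large `n`, no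
contact scheme on `N = 2^n` variables with at most `⌊N^κ⌋` contacts co-solves `⟨Y, approxHardNo α ρ⟩`
(for `Y` as above). [folklore] -/
theorem eventually_not_coSolves_of_le_powSize {α ρ κ : ℝ} (hα : 0 < α) (hα1 : α < 1) (hρ : 0 < ρ)
    (hκ : κ < 1) {Y : Set (List Bool)}
    (hY : ∀ᶠ n : ℕ in atTop, ∃ f₀ : (Fin n → Bool) → Bool, truthTable f₀ ∈ Y) :
    ∀ᶠ n : ℕ in atTop, ∀ P : NondetBranchingProgram (2 ^ n),
      P.size ≤ powSize κ (2 ^ n) → ¬ P.CoSolves ⟨Y, approxHardNo α ρ⟩ := by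
  set γ : ℝ := max (max α (1 - ρ * α)) κ with hγdef
  have hγ1 : γ < 1 := max_lt (max_lt hα1 (by nlinarith [mul_pos hρ hα])) hκ
  have hγ0 : 0 < γ := lt_max_of_lt_left (lt_max_of_lt_left hα)
  obtain ⟨θ, hγθ, hθ1⟩ := exists_between hγ1
  have hθ0 : 0 < θ := hγ0.trans hγθ
  have hθ' : max α (1 - ρ * α) < θ := lt_of_le_of_lt (le_max_left _ _) hγθ
  have hκθ : κ ≤ θ := (le_max_right _ _).trans hγθ.le
  filter_upwards [eventually_not_coSolves_of_le_sub hα hθ' hθ1.le hY,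
    eventually_powSize_le_sub hκθ hθ0 hθ1] with n hn hle P hP
  exact hn P (hP.trans hle)

/-! ### Row R28's own predicates: renderings (I) and (II) -/

/-- **Rendering (I), sub-threshold form**: for `α > 0`, `θ ∈ (max α (1−ρα), 1]` and every family
index `c`, eventually no contact scheme with `≤ N − ⌈N^θ⌉` contacts co-solves the `c`-th member
`DSPACEvsApproxSIZE c α ρ` (YES witness: the constant function, `truthTable_const_mem_yes`).
[folklore] -/
theorem DSPACEvsApproxSIZE_not_coSolved_of_le_sub {ρ α θ : ℝ} (c : ℕ) (hα : 0 < α)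
    (hθ : max α (1 - ρ * α) < θ) (hθ1 : θ ≤ 1) :
    ∀ᶠ n : ℕ in atTop, ∀ P : NondetBranchingProgram (2 ^ n),
      P.size ≤ 2 ^ n - ⌈((2 : ℝ) ^ n) ^ θ⌉₊ → ¬ P.CoSolves (DSPACEvsApproxSIZE c α ρ) :=
  eventually_not_coSolves_of_le_sub (Y := smallBPYes c) hα hθ hθ1
    (Eventually.of_forall fun n => ⟨fun _ => false, truthTable_const_mem_yes c α ρ n⟩)

/-- **Rendering (I), polynomial form (row R28's K cell)**: for `0 < α < 1`, `0 < ρ`, every `c` and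
every `κ < 1`, eventually no contact scheme — read-once or not — with `≤ ⌊N^κ⌋` contacts co-solves
`DSPACEvsApproxSIZE c α ρ`. NEEDED (Thm. 1.13): exponent `1 + β`, `β > 0`, read-once. [folklore] -/
theorem DSPACEvsApproxSIZE_not_coSolved_of_lt_one {ρ α κ : ℝ} (c : ℕ) (hα : 0 < α) (hα1 : α < 1)
    (hρ : 0 < ρ) (hκ : κ < 1) :
    ∀ᶠ n : ℕ in atTop, ∀ P : NondetBranchingProgram (2 ^ n),
      P.size ≤ powSize κ (2 ^ n) → ¬ P.CoSolves (DSPACEvsApproxSIZE c α ρ) :=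
  eventually_not_coSolves_of_le_powSize (Y := smallBPYes c) hα hα1 hρ hκ
    (Eventually.of_forall fun n => ⟨fun _ => false, truthTable_const_mem_yes c α ρ n⟩)

/-- **THE NEEDED PREDICATE AT EVERY NEGATIVE `β` (rendering (I)).** For `0 < α < 1`, `0 < ρ`, every
`c` and every `β < 0`: `Thm113Hypothesis ρ α β c` holds (budget `powSize (1+β)`, `1 + β < 1`; the
read-once proviso is not even used). Thm. 1.13 NEEDS it for some `β > 0`. [folklore] -/
theorem thm113Hypothesis_of_neg {ρ α β : ℝ} (c : ℕ) (hα : 0 < α) (hα1 : α < 1) (hρ : 0 < ρ)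
    (hβ : β < 0) : Thm113Hypothesis ρ α β c := by
  filter_upwards [DSPACEvsApproxSIZE_not_coSolved_of_lt_one c hα hα1 hρ (by linarith : 1 + β < 1)]
    with n hn P _ hP
  exact hn P hP

/-- **Rendering (II), polynomial form**: for `1 ≤ c` (so that Π_YES is inhabited,
`truthTable_const_mem_dlYes`; `dlYes 0 = ∅`), `0 < α < 1`, `0 < ρ` and every `κ < 1`, eventually no
contact scheme with `≤ ⌊N^κ⌋` contacts co-solves `DSPACEdlVsApproxSIZE c α ρ`. [folklore] -/
theorem DSPACEdlVsApproxSIZE_not_coSolved_of_lt_one {ρ α κ : ℝ} {c : ℕ} (hc : 1 ≤ c) (hα : 0 < α)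
    (hα1 : α < 1) (hρ : 0 < ρ) (hκ : κ < 1) :
    ∀ᶠ n : ℕ in atTop, ∀ P : NondetBranchingProgram (2 ^ n),
      P.size ≤ powSize κ (2 ^ n) → ¬ P.CoSolves (DSPACEdlVsApproxSIZE c α ρ) := by
  refine eventually_not_coSolves_of_le_powSize (Y := dlYes c) hα hα1 hρ hκ ?_
  filter_upwards [eventually_ge_atTop 2] with n hn
  have h2 : 2 ≤ c * n := hn.trans (by simpa using Nat.mul_le_mul_right n hc)
  exact ⟨fun _ => false, truthTable_const_mem_dlYes h2 α ρ⟩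

/-- **Rendering (II), sub-threshold form** (`1 ≤ c`, `α > 0`, `θ ∈ (max α (1−ρα), 1]`). [folklore] -/
theorem DSPACEdlVsApproxSIZE_not_coSolved_of_le_sub {ρ α θ : ℝ} {c : ℕ} (hc : 1 ≤ c) (hα : 0 < α)
    (hθ : max α (1 - ρ * α) < θ) (hθ1 : θ ≤ 1) :
    ∀ᶠ n : ℕ in atTop, ∀ P : NondetBranchingProgram (2 ^ n),
      P.size ≤ 2 ^ n - ⌈((2 : ℝ) ^ n) ^ θ⌉₊ → ¬ P.CoSolves (DSPACEdlVsApproxSIZE c α ρ) := by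
  refine eventually_not_coSolves_of_le_sub (Y := dlYes c) hα hθ hθ1 ?_
  filter_upwards [eventually_ge_atTop 2] with n hn
  have h2 : 2 ≤ c * n := hn.trans (by simpa using Nat.mul_le_mul_right n hc)
  exact ⟨fun _ => false, truthTable_const_mem_dlYes h2 α ρ⟩

/-- **THE NEEDED PREDICATE AT EVERY NEGATIVE `β` (rendering (II)).** For `1 ≤ c`, `0 < α < 1`,
`0 < ρ` and every `β < 0`: `Thm113HypothesisDL ρ α β c` holds. [folklore] -/
theorem thm113HypothesisDL_of_neg {ρ α β : ℝ} {c : ℕ} (hc : 1 ≤ c) (hα : 0 < α) (hα1 : α < 1)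
    (hρ : 0 < ρ) (hβ : β < 0) : Thm113HypothesisDL ρ α β c := by
  filter_upwards [DSPACEdlVsApproxSIZE_not_coSolved_of_lt_one hc hα hα1 hρ
    (by linarith : 1 + β < 1)] with n hn P _ hP
  exact hn P hP

end Hirahara2020

end Literature.Computability.MetaComplexity
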